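import Mathlib
import Summits.Ventures.HodgeRepro2.Tier7.Line1.SepActH10

/-!
# Tier7/Line1/SepBar — complex conjugation on the separating datum

The SEPARATING DATUM of t7-L1-p2 (LINE L1, residual probe). Conjugation on the first curve `A₁`: `conj` on the
scalars and `(u, ū) ↦ (conj ū, conj u)` on `U × U` (`barData₁`, `bar₁`); on `HXS J`: `bar₁` on the `A₁`-coefficients,
`e k ↔ ē k` on the second curve, and a given antilinear involution `jb` on the junk (`barData`, `barH`). Both are
`Curve.BarData` of `SepCurveAut`, so additive, multiplicative, antilinear involutions. The Hecke generators commute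
with the conjugation (`gen_barH`), hence the whole group does (`bar_act`). Author: t7-L1-p2
(prover-pub-hodge-repro2-t7-L1-p2-g0-0). §8(d): NO.
-/

namespace Summit.Ventures.HodgeRepro2.Tier7.Line1.Sep

open Finset Summit.Ventures.HodgeRepro2.Tier7

noncomputable section

/-! ## Conjugation on the first curve -/

/-- `conjF 0 = 0` -/
@[simp] theorem conjF_zero : conjF (0 : Ω → ℂ) = 0 := by
  funext ω; simp [conjF]

/-- `conjU 0 = 0` -/
@[simp] theorem conjU_zero : conjU (0 : U) = 0 := Subtype.ext (by simp)

/-- the conjugation data of the first curve -/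
def barData₁ : Curve.BarData (R := ℂ) (V := V₁) (J := Unit) β₁ where
  bR := starRingEnd ℂ
  bV v := (conjU v.2, conjU v.1)
  bJ := id
  bR_add := map_add _
  bR_mul := map_mul _
  bR_one := map_one _
  bR_smul z x := by simp [smul_eq_mul]
  bR_bR := Complex.conj_conj
  bV_add v w := by simp [conjU_add]
  bV_smul r v := by simp [conjU_smul]
  bV_bV v := by simp [conjU_conjU]
  bJ_add _ _ := rfl
  bJ_smul _ _ := rfl
  bJ_bJ _ := rfl
  β_bar v w := by
    simp only [β₁_apply, Bform_conjU, map_add]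
    rw [Bform_comm v.2 w.1, Bform_comm w.2 v.1, add_comm]

/-- conjugation on the first curve -/
def bar₁ : A₁ → A₁ := barData₁.bar

/-- `bar₁` on the components -/
theorem bar₁_apply (x : A₁) :
    bar₁ x = ⟨(starRingEnd ℂ) x.c, (conjU x.v.2, conjU x.v.1), (starRingEnd ℂ) x.t, ()⟩ := rfl

/-- `bar₁` is additive -/
theorem bar₁_add (x y : A₁) : bar₁ (x + y) = bar₁ x + bar₁ y := barData₁.bar_add x y

/-- `bar₁` is multiplicative -/
theorem bar₁_mul (x y : A₁) : bar₁ (x * y) = bar₁ x * bar₁ y := barData₁.bar_mul x y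

/-- `bar₁` is an involution -/
theorem bar₁_bar₁ (x : A₁) : bar₁ (bar₁ x) = x := barData₁.bar_bar x

/-- `bar₁` is antilinear -/
theorem bar₁_smul (z : ℂ) (x : A₁) : bar₁ (z • x) = (starRingEnd ℂ) z • bar₁ x := barData₁.bar_smul z x

/-- `bar₁ 1 = 1` -/
theorem bar₁_one : bar₁ (1 : A₁) = 1 := by
  rw [bar₁_apply]; ext <;> simp [conjU]

/-- `bar₁ 0 = 0` -/
theorem bar₁_zero : bar₁ (0 : A₁) = 0 := barData₁.bar_zero

/-- the augmentation of a conjugate -/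
@[simp] theorem bar₁_c (x : A₁) : (bar₁ x).c = (starRingEnd ℂ) x.c := rfl

/-- the top coefficient of a conjugate -/
@[simp] theorem bar₁_t (x : A₁) : (bar₁ x).t = (starRingEnd ℂ) x.t := rfl

/-- `bar₁` of a holomorphic class -/
theorem bar₁_holA (u : U) : bar₁ (holA u) = antiA (conjU u) := by
  rw [bar₁_apply]; simp [holA, antiA, conjU]

/-- `bar₁` of an antiholomorphic class -/
theorem bar₁_antiA (u : U) : bar₁ (antiA u) = holA (conjU u) := by
  rw [bar₁_apply]; simp [holA, antiA, conjU]

/-- `bar₁` fixes the top class -/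
theorem bar₁_topA : bar₁ topA = topA := by
  rw [bar₁_apply]; simp [topA, conjU]

/-- `bar₁` as an additive map -/
def bar₁AddHom : A₁ →+ A₁ := AddMonoidHom.mk' bar₁ bar₁_add

/-- `bar₁AddHom` unfolded -/
@[simp] theorem bar₁AddHom_apply (x : A₁) : bar₁AddHom x = bar₁ x := rfl

/-- `bar₁` commutes with the automorphism of an automorphism of `U` commuting with `conjU` -/
theorem bar₁_algEquiv₁ (a : UAut) (hc : ∀ u, a.ρ (conjU u) = conjU (a.ρ u)) (x : A₁) :
    bar₁ (a.algEquiv₁ x) = a.algEquiv₁ (bar₁ x) := by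
  rw [UAut.algEquiv₁_apply, bar₁_apply, bar₁_apply, UAut.algEquiv₁_apply]
  simp [hc]

/-! ## Conjugation on `HXS J` -/

/-- an antilinear involution of the junk -/
structure JBar (J : Type) [AddCommGroup J] [Module ℂ J] where
  /-- the involution -/
  b : J → J
  /-- additive -/
  b_add : ∀ x y, b (x + y) = b x + b y
  /-- antilinear -/
  b_smul : ∀ (z : ℂ) (x : J), b (z • x) = (starRingEnd ℂ) z • b x
  /-- involutive -/
  b_b : ∀ x, b (b x) = x

variable {J : Type} [AddCommGroup J] [Module ℂ J] (jb : JBar J)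

/-- `b 0 = 0` -/
theorem JBar.b_zero : jb.b 0 = 0 := by
  have := jb.b_smul 0 0
  rwa [zero_smul, map_zero, zero_smul] at this

/-- the conjugation data of `HXS J` -/
def barData : Curve.BarData (R := A₁) (V := V₂) (J := Junk J) β₂ where
  bR := bar₁
  bV v := (fun k => bar₁ (v.2 k), fun k => bar₁ (v.1 k))
  bJ := jb.b
  bR_add := bar₁_add
  bR_mul := bar₁_mul
  bR_one := bar₁_one
  bR_smul := bar₁_smul
  bR_bR := bar₁_bar₁
  bV_add v w := by ext k <;> simp [bar₁_add]
  bV_smul r v := by ext k <;> simp [bar₁_mul]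
  bV_bV v := by ext k <;> simp [bar₁_bar₁]
  bJ_add := jb.b_add
  bJ_smul r j := by
    rw [Junk.smul_def, Junk.smul_def, bar₁_c]
    exact jb.b_smul _ _
  bJ_bJ := jb.b_b
  β_bar v w := by
    simp only [β₂_apply]
    rw [show bar₁ (∑ k, (v.1 k * w.2 k + w.1 k * v.2 k)) =
      ∑ k, bar₁ (v.1 k * w.2 k + w.1 k * v.2 k) from map_sum bar₁AddHom _ _]
    refine Finset.sum_congr rfl fun k _ => ?_
    simp only [bar₁_add, bar₁_mul]
    ring

/-- conjugation on `HXS J` -/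
def barH : HXS J → HXS J := (barData jb).bar

/-- `barH` on the components -/
theorem barH_apply (x : HXS J) :
    barH jb x = ⟨bar₁ x.c, (fun k => bar₁ (x.v.2 k), fun k => bar₁ (x.v.1 k)), bar₁ x.t, jb.b x.j⟩ := rfl

/-- `barH` is additive -/
theorem barH_add (x y : HXS J) : barH jb (x + y) = barH jb x + barH jb y := (barData jb).bar_add x y

/-- `barH` is multiplicative -/
theorem barH_mul (x y : HXS J) : barH jb (x * y) = barH jb x * barH jb y := (barData jb).bar_mul x y

/-- `barH` is an involution -/
theorem barH_barH (x : HXS J) : barH jb (barH jb x) = x := (barData jb).bar_bar x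

/-- `barH` is antilinear -/
theorem barH_smul (z : ℂ) (x : HXS J) : barH jb (z • x) = (starRingEnd ℂ) z • barH jb x :=
  (barData jb).bar_smul z x

/-- `barH` of an image of the model -/
theorem barH_ι (x : M) : barH jb (ι x) = ⟨0, (0, fun k => antiA (conjU (x k))), 0, 0⟩ := by
  rw [ι_apply, barH_apply]
  simp only [bar₁_zero, bar₁_holA, Pi.zero_apply]
  refine Curve.ext rfl (Prod.ext (funext fun _ => rfl) rfl) rfl ?_
  exact jb.b_zero

/-! ## The generators commute with the conjugation -/

/-- a generator datum compatible with `bar₁` and with real signs commutes with `barH` -/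
theorem HAutData.barH_algEquiv (D : HAutData) (hσ : ∀ y, bar₁ (D.σ₁ y) = D.σ₁ (bar₁ y))
    (hε : ∀ k, (starRingEnd ℂ) (D.ε k) = D.ε k) (a : HXS J) :
    barH jb (D.algEquiv a) = D.algEquiv (barH jb a) := by
  rw [HAutData.algEquiv_apply, barH_apply, barH_apply, HAutData.algEquiv_apply]
  refine Curve.ext (hσ _) ?_ (hσ _) rfl
  refine Prod.ext (funext fun k => ?_) (funext fun k => ?_)
  · simp only [HAutData.actFun_apply, bar₁_smul, hε, hσ]
  · simp only [HAutData.actFun_apply, bar₁_smul, hε, hσ]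

/-- every generator commutes with the conjugation -/
theorem gen_barH (s : Bool × Option ℕ) (a : HXS J) : gen J s (barH jb a) = barH jb (gen J s a) := by
  rcases s with ⟨b, n⟩
  rcases b with _ | _ <;> rcases n with _ | n
  · exact (HAutData.barH_algEquiv jb _ (fun _ => rfl) (fun _ => by simp [genData, HAutData.swap]) a).symm
  · exact (HAutData.barH_algEquiv jb _
      (bar₁_algEquiv₁ (UAut.flip n) fun u => (conjU_flipU n u).symm)
      (fun _ => by simp [genData, HAutData.ofUAut]) a).symm
  · exact (HAutData.barH_algEquiv jb _ (fun _ => rfl)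
      (fun k => by fin_cases k <;> simp [genData, HAutData.sign, signK]) a).symm
  · exact (HAutData.barH_algEquiv jb _
      (bar₁_algEquiv₁ (UAut.sgn n) fun u => (conjU_sgnU n u).symm)
      (fun _ => by simp [genData, HAutData.ofUAut]) a).symm

/-- the conjugation commutes with the Hecke translates -/
theorem bar_act (g : G) (a : HXS J) : barH jb (g • a) = g • barH jb a :=
  lift_gen_prop (J := J) (fun φ => ∀ a, barH jb (φ a) = φ (barH jb a)) (fun a => by simp)
    (fun s a => (gen_barH jb s a).symm)
    (fun φ ψ hφ hψ a => by rw [AlgEquiv.mul_apply, AlgEquiv.mul_apply, hφ, hψ]) g a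

end

end Summit.Ventures.HodgeRepro2.Tier7.Line1.Sep
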